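import Mathlib.Analysis.SpecialFunctions.Pow.Real
import Mathlib.Analysis.SpecialFunctions.Sqrt
import HarnessLib

/-!
# The window radius `R(L) = c_R · L⁻⁴¹` of the final assembly of ⟨stmt-QuantumFields-24204⟩ `VirialFluxGap.SharpTwistedLaplace`
# (real arithmetic: all window inequalities of ✓`fix_htube_of_phasePackage''` hold for this choice)

Helper module (free-hands work of width seat ym-line-sfw-p2-w3 g57, cell ym-idea-1; `--supports 24204`).  With the slice datum of
✓`exists_phase_package_fixCoord'` (`λ = 2·10⁻²²L⁻³³`, `A₃ = 288L⁴(√2)³ + 26880L⁴·10⁻⁷L⁻¹¹`, `A₄ = 26880L⁴`, window `10⁻⁷L⁻¹¹`) and the anchor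
constants `r₀ > 0`, `D, G ≥ 0` of ✓`fix_htube_of_phasePackage'`:
* `sqrt_two_pow_three_le`, `phaseA₃_le` (`A₃ ≤ 27744L⁴`);
* ★ `window_choice` — with `c_R = min(10⁻³⁰, r₀/2)/(1 + D + G)` and `R = c_R/L⁴¹` (`L ≥ 1`): `0 < R < 1`, `R ≤ r₀`, `R ≤ 10⁻⁷L⁻¹¹`,
  `A₃R + A₄R² ≤ λ/(8(18L⁴+8))`, `DR ≤ 1`, `GR² ≤ 1`.
Everything here is PROVED; no definitions, no named facts.  HONEST FRAMING: arithmetic; ⟨24204⟩, ⟨24319⟩ and every rung stay OPEN; the Yang–Mills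
mass gap (Clay) is NOT touched; no summit is proved by a line.

## References
* K. W. Breitung, *Asymptotic Approximations for Probability Integrals*, LNM 1592 (1994), Thm 41 p. 56. [Breitung1994]
-/

set_option autoImplicit false

noncomputable section

namespace Summit.QuantumFields.YangMills.Theorems.VirialFluxGap.FixSplit

/-- `(√2)³ ≤ 3`. [folklore] -/
theorem sqrt_two_pow_three_le : Real.sqrt 2 ^ 3 ≤ 3 := by
  have h2 : Real.sqrt 2 ^ 2 = 2 := Real.sq_sqrt (by norm_num)
  have hs : Real.sqrt 2 ≤ 3 / 2 := by
    rw [show (3 / 2 : ℝ) = Real.sqrt ((3 / 2) ^ 2) by rw [Real.sqrt_sq (by norm_num)]]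
    exact Real.sqrt_le_sqrt (by norm_num)
  have h0 : 0 ≤ Real.sqrt 2 := Real.sqrt_nonneg 2
  nlinarith

/-- The cubic constant of the phase package is at most `27744 L⁴` (`L ≥ 1`). [cite: Breitung1994, Thm 41 p. 56] -/
theorem phaseA₃_le {Lr : ℝ} (hL : 1 ≤ Lr) :
    288 * Lr ^ 4 * Real.sqrt 2 ^ 3 + 26880 * Lr ^ 4 * (1 / (10 ^ 7 * Lr ^ 11)) ≤ 27744 * Lr ^ 4 := by
  have hL4 : 0 ≤ Lr ^ 4 := by positivity
  have h1 : 1 / (10 ^ 7 * Lr ^ 11) ≤ 1 := by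
    rw [div_le_one (by positivity)]
    exact one_le_mul_of_one_le_of_one_le (by norm_num) (one_le_pow₀ hL)
  have h2 := sqrt_two_pow_three_le
  nlinarith [mul_le_mul_of_nonneg_left h2 (by positivity : (0 : ℝ) ≤ 288 * Lr ^ 4),
    mul_le_mul_of_nonneg_left h1 (by positivity : (0 : ℝ) ≤ 26880 * Lr ^ 4)]

/-- ★ **The window radius** `R = c_R/L⁴¹`, `c_R = min(10⁻³⁰, r₀/2)/(1 + D + G)`, satisfies every window inequality of the per-tube theorem.
[cite: Breitung1994, Thm 41 p. 56] -/
theorem window_choice {r₀ D G : ℝ} (hr₀ : 0 < r₀) (hD : 0 ≤ D) (hG : 0 ≤ G) {Lr : ℝ} (hL : 1 ≤ Lr) :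
    0 < min (1 / 10 ^ 30) (r₀ / 2) / (1 + D + G) / Lr ^ 41 ∧
    min (1 / 10 ^ 30) (r₀ / 2) / (1 + D + G) / Lr ^ 41 < 1 ∧
    min (1 / 10 ^ 30) (r₀ / 2) / (1 + D + G) / Lr ^ 41 ≤ r₀ ∧
    min (1 / 10 ^ 30) (r₀ / 2) / (1 + D + G) / Lr ^ 41 ≤ 1 / (10 ^ 7 * Lr ^ 11) ∧
    (288 * Lr ^ 4 * Real.sqrt 2 ^ 3 + 26880 * Lr ^ 4 * (1 / (10 ^ 7 * Lr ^ 11))) * (min (1 / 10 ^ 30) (r₀ / 2) / (1 + D + G) / Lr ^ 41) +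
        (26880 * Lr ^ 4) * (min (1 / 10 ^ 30) (r₀ / 2) / (1 + D + G) / Lr ^ 41) ^ 2 ≤
      (2 / (10 ^ 22 * Lr ^ 33)) / (8 * (18 * Lr ^ 4 + 8)) ∧
    D * (min (1 / 10 ^ 30) (r₀ / 2) / (1 + D + G) / Lr ^ 41) ≤ 1 ∧
    G * (min (1 / 10 ^ 30) (r₀ / 2) / (1 + D + G) / Lr ^ 41) ^ 2 ≤ 1 := by
  set m : ℝ := min (1 / 10 ^ 30) (r₀ / 2) with hm
  set cR : ℝ := m / (1 + D + G) with hcR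
  set R : ℝ := cR / Lr ^ 41 with hRdef
  have hL0 : 0 < Lr := by linarith
  have hm0 : 0 < m := lt_min (by norm_num) (by linarith)
  have hm30 : m ≤ 1 / 10 ^ 30 := min_le_left _ _
  have hmr : m ≤ r₀ / 2 := min_le_right _ _
  have hDG : 1 ≤ 1 + D + G := by linarith
  have hDG0 : 0 < 1 + D + G := by linarith
  have hcR0 : 0 < cR := div_pos hm0 hDG0
  have hcRm : cR ≤ m := div_le_self hm0.le hDG
  have hL41 : 1 ≤ Lr ^ 41 := one_le_pow₀ hL
  have hR0 : 0 < R := div_pos hcR0 (by positivity)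
  have hRcR : R ≤ cR := div_le_self hcR0.le hL41
  have hR30 : R ≤ 1 / 10 ^ 30 := hRcR.trans (hcRm.trans hm30)
  have hR1 : R ≤ 1 := hR30.trans (by norm_num)
  refine ⟨hR0, lt_of_le_of_lt hR30 (by norm_num), ?_, ?_, ?_, ?_, ?_⟩
  · linarith [hRcR.trans (hcRm.trans hmr)]
  · -- `R ≤ 10⁻⁷ L⁻¹¹`
    have h1 : R ≤ 1 / 10 ^ 30 / Lr ^ 41 := by
      rw [hRdef]; exact div_le_div_of_nonneg_right (hcRm.trans hm30) (by positivity)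
    have h2 : 1 / 10 ^ 30 / Lr ^ 41 ≤ 1 / (10 ^ 7 * Lr ^ 11) := by
      rw [div_div]
      refine div_le_div_of_nonneg_left (by norm_num) (by positivity) ?_
      have : Lr ^ 11 ≤ Lr ^ 41 := pow_le_pow_right₀ hL (by norm_num)
      nlinarith [pow_pos hL0 11]
    exact h1.trans h2
  · -- `hsmall`
    have hA3 := phaseA₃_le hL
    have hL4 : 1 ≤ Lr ^ 4 := one_le_pow₀ hL
    have hlhs : (288 * Lr ^ 4 * Real.sqrt 2 ^ 3 + 26880 * Lr ^ 4 * (1 / (10 ^ 7 * Lr ^ 11))) * R + (26880 * Lr ^ 4) * R ^ 2 ≤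
        54624 * Lr ^ 4 * R := by
      have hR2 : R ^ 2 ≤ R := by nlinarith
      nlinarith [mul_le_mul_of_nonneg_right hA3 hR0.le, mul_le_mul_of_nonneg_left hR2 (by positivity : (0 : ℝ) ≤ 26880 * Lr ^ 4)]
    have h1 : 54624 * Lr ^ 4 * R ≤ 54624 * Lr ^ 4 * (1 / 10 ^ 30 / Lr ^ 41) := by
      refine mul_le_mul_of_nonneg_left ?_ (by positivity)
      rw [hRdef]; exact div_le_div_of_nonneg_right (hcRm.trans hm30) (by positivity)
    have h2 : 54624 * Lr ^ 4 * (1 / 10 ^ 30 / Lr ^ 41) = 54624 / 10 ^ 30 / Lr ^ 37 := by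
      field_simp
    have h3 : (2 / (10 ^ 22 * Lr ^ 33)) / (8 * (26 * Lr ^ 4)) ≤ (2 / (10 ^ 22 * Lr ^ 33)) / (8 * (18 * Lr ^ 4 + 8)) := by
      refine div_le_div_of_nonneg_left (by positivity) (by positivity) ?_
      nlinarith
    have h4 : (2 / (10 ^ 22 * Lr ^ 33)) / (8 * (26 * Lr ^ 4)) = 2 / (208 * 10 ^ 22) / Lr ^ 37 := by
      field_simp
      ring
    have h5 : 54624 / 10 ^ 30 / Lr ^ 37 ≤ 2 / (208 * 10 ^ 22) / Lr ^ 37 :=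
      div_le_div_of_nonneg_right (by norm_num) (by positivity)
    calc _ ≤ 54624 * Lr ^ 4 * R := hlhs
      _ ≤ 54624 * Lr ^ 4 * (1 / 10 ^ 30 / Lr ^ 41) := h1
      _ = 54624 / 10 ^ 30 / Lr ^ 37 := h2
      _ ≤ 2 / (208 * 10 ^ 22) / Lr ^ 37 := h5
      _ = (2 / (10 ^ 22 * Lr ^ 33)) / (8 * (26 * Lr ^ 4)) := h4.symm
      _ ≤ _ := h3
  · -- `D R ≤ 1`
    have h1 : D * R ≤ D * cR := mul_le_mul_of_nonneg_left hRcR hD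
    have h2 : D * cR ≤ 1 := by
      rw [hcR, mul_div_assoc']
      rw [div_le_one hDG0]
      nlinarith [hm30]
    exact h1.trans h2
  · -- `G R² ≤ 1`
    have h1 : G * R ^ 2 ≤ G * cR := by
      have : R ^ 2 ≤ cR := by nlinarith
      exact mul_le_mul_of_nonneg_left this hG
    have h2 : G * cR ≤ 1 := by
      rw [hcR, mul_div_assoc', div_le_one hDG0]
      nlinarith [hm30]
    exact h1.trans h2

end Summit.QuantumFields.YangMills.Theorems.VirialFluxGap.FixSplit

end
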